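import Summits.ABC.IUTFork.Cor312GenuineKDeepDatumLam
import Literature.IUT.LogVolume.LocalDegreeGlobalBounds
import HarnessLib

/-!
# Branch C / R-W «C:HSHW-REF», per-datum preliminaries: the norm of the chosen realising q-idele at EVERY bad place of a genuine
# Θ-volume datum, and — at RATIONAL `λ`-line points — `‖t_{q,x₀}‖ = p^{ord_p(j(λ))/(2l)}`, `l ∣ e(x₀|p)` (so `l ≤ [K:ℚ]`) when
# `l ∤ ord_p(j(λ))`, and the DEGREE-FORM depth locus is EMPTY for small pole orders (beyond «all bad `h_v ≤ 16`»)

PROOF-ONLY support file (D-0012; 0 definitions, 0 `Prop` facts, no instance, no notation) of the abc-iut cell (seat abc-iut-w6-d102,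
gen 3; R-W lane P−, task «C:HSHW-REF» of plan RULING C-R39 (4) / C-R39a: the input «(i) ¬deep» of abc-iut-W-neg-2's composition
`not_hSHwBad_of_not_pilotKummerCompatHull` (p463028) at the tier-1 Frey–Legendre datum `2·5¹⁰·13⁴ + 3¹⁵·7·31⁷·45817 = 11⁸·109²·3677³`,
`l = 13`, whose bad local heights `h_3 = 30`, `h_5 = 20` EXCEED the `16` of abc-iut-w4-d078's
`Cor22.ThetaVolumeDatumAt.not_deep_of_forall_localHeight_le` (p-id in HOME/STATUS), so a finer test is needed). TAKES NO SIDE on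
[IUTchIII] Cor. 3.12 (S. Mochizuki, *Inter-universal Teichmüller theory III*, RIMS manuscript, Cor. 3.12 p. 173–174, Step (xi-f)
p. 184) or on any author: bookkeeping over OUR typed objects (abc-iut-C-cert-3's CHOSEN realising q-idele of `pilotDataOfK T.D T.K`).

WHAT IS PROVED (composition BY NAME; no new engine).
* §1 `GenuineK.exists_int_norm_qIdele_chosen` — at a genuine Θ-volume datum `T` over `(P, l)`, at EVERY point `x₀` of the fibre over
  `p` whose place is bad: `‖t_{q,x₀}‖ = p^{−m_q/e(x₀|p)}` with `m_q ∈ ℤ` and `m_q/e(x₀|p) = −ord_{v₀}(j(λ))/(2l·e(v₀|p))`, `v₀` the place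
  of `F_tpd` under `x₀` (ALL relative ramification indices cancel; abc-iut-c312-7's `exists_int_norm_qIdele_pilotDataOfK` /
  `qExponent_div_eq_pilotDataOfK` and `GenuineK.exists_bad_tame_place_of_ord_neg` — there for the ONE place constructed, here for every
  bad place —, abc-iut-w5-d009's `neg_ord_j_eq_ramificationIdx_mul_qParamOrd_of_under_mem_VFbad`, `Cor22.ord_algebraMap_eq`).
* §2 at a RATIONAL point `(ratPoint λ, l)` (`e(v₀|p) = 1`), the place `v₀` of `ℚ` under `x₀` being passed as a
  variable of type `HeightOneSpectrum (𝓞 ℚ)` with its defining equation (so statements about it live over `ℚ` verbatim):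
  `GenuineK.natGenerator_eq_of_eq_finBelow_placeOf` (`p_{v₀} = p`), `GenuineK.norm_qIdele_chosen_ratPoint` (bad place:
  `‖t_{q,x₀}‖ = p^{ord_{v₀}(j(λ))/(2l)}` and `2l·m_q = −ord_{v₀}(j(λ))·e(x₀|p)`), `GenuineK.le_finrank_of_bad_place_ratPoint` (`l` prime,
  `l ∤ ord_{v₀}(j(λ))` ⟹ `l ∣ e(x₀|p)` and `l ≤ [K:ℚ]`, by the tree's `absRamificationIdx_rescaledCompletion_le_finrank_rat`).
* §3 `GenuineK.not_degreeDeep_ratPoint` — the DEGREE-FORM depth locus of the window certificates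
  (`∃ p > 2, i, x₀ : p^{((i+2)(4 + 2·log_p[K:ℚ]) + 1)}·‖t_{q,x₀}‖^{(i+1)²−1} < 1`, the antecedent of `hSHwBad` in
  `Conditional.abc_of_SH_v10K_window_szpiroBadAll`, VERBATIM) is EMPTY at every genuine datum over a rational point whose pole orders
  satisfy `−ord_p(j(λ))·(l−3) ≤ 16·l` at `p ≠ 3` and `−ord_3(j(λ))·(l−3) ≤ 24·l`, once `3 ≤ [K:ℚ]`: off the bad set `‖t_{q,x₀}‖ = 1`;
  at a bad place `(M/(2l))·i ≤ M(l−3)/(4l) ≤ 4 + 2·log_p[K:ℚ]` (`i ≤ (l−3)/2`; `log_3[K:ℚ] ≥ 1`). At the tier-1 datum, `l = 13`: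
  `20·10 ≤ 208` and `30·10 ≤ 312`.
HONEST SCOPE: bookkeeping over OUR typed objects; nothing here bears on the printed inequality of [IUTchIII] Cor. 3.12 or on
`Cor22.Cor312AtDatum`; typed ≠ proved; instantiated ≠ endorsed; no abc claim.
[cite: Mochizuki2012, IUTchI Def. 3.1 (c) p. 62, Ex. 3.2 (iv) p. 71; IUTchIV Prop. 1.2 p. 10, Thm. 1.10 p. 22–23, Cor. 2.2 (P2)(P5) p. 45–46]
[cite: NeukirchANT1999, Ch. I Prop. (8.2), Ch. II Prop. (6.8)] [cite: DupuyHilado2025, §3.3, §3.4] [claim: Mochizuki2012, status: disputed]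
for every IUT quotation.
-/

noncomputable section

open Set Function NumberField IsDedekindDomain

namespace Summit.ABC.IUTFork.Conditional

open Thm311 Thm311.Real Cor312 Cor312Prov Literature.IUT.LogVolume Literature.IUT.HodgeTheaters
  Literature.IUT.LogThetaLattice Literature.NumberTheory.NumberFields Literature.NumberTheory.DiophantineGeometry.GenEll
  Literature.NumberTheory.DiophantineGeometry

/-! ## §1. The norm of the chosen realising q-idele at EVERY bad place of a genuine datum -/

section Genuine

variable {P : NFPoint} {l : ℕ} (T : Cor22.ThetaVolumeDatumAt P l)

/-- **`‖t_{q,x₀}‖ = p^{−m_q/e(x₀|p)}` with `m_q/e(x₀|p) = −ord_{v₀}(j(λ))/(2l·e(v₀|p))` at EVERY bad place.** For a genuine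
Θ-volume datum `T` over `(P, l)` and a point `x₀` of the fibre over `p` of the index of `pilotDataOfK T.D T.K` whose place `w` is
bad (`∈ S`), with `v = w ∩ F`, `v₀ = v ∩ F_tpd`: the CHOSEN realising q-idele has `‖t_{q,x₀}‖ = p^{−m_q/e(w|p)}` for an integer
`m_q` (`ord_w(q) = 2l·m_q`, [IUTchI] Ex. 3.2 (iv)) and `m_q/e(w|p) = −ord_{v₀}(j(λ))/(2l·e(v₀|p))` — `ord_w(q) = e(w|v)·ord_v(q_v)`,
`ord_v(q_v) = −ord_v(j_E) = −e(v|v₀)·ord_{v₀}(j(λ))` (`T.j_eq`), `e(w|p) = e(v₀|p)·e(v|v₀)·e(w|v)`: every relative index cancels.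
[cite: Mochizuki2012, IUTchI Def. 3.1 (c) p. 62, Ex. 3.2 (iv) p. 71; IUTchIV Cor. 2.2 (P2) p. 45] [cite: NeukirchANT1999, Ch. II Prop. (6.8)]
[claim: Mochizuki2012, status: disputed] -/
theorem GenuineK.exists_int_norm_qIdele_chosen (pp : Nat.Primes) :
    letI := T.instFieldF; letI := T.instNumberFieldF; letI := T.instAlgebraF; letI := T.instFieldK
    letI := T.instNumberFieldK; letI := T.instAlgebraK; letI := T.instFieldFbar; letI := T.instAlgebraFbar
    letI := T.instAlgebraKFbar; letI := T.instIsElliptic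
    haveI : Fact (pp : ℕ).Prime := ⟨pp.2⟩
    ∀ x₀ : (thetaIndex (pilotDataOfK T.D T.K)).Fibre (.inr pp),
      placeOf (pilotDataOfK T.D T.K) pp.1 x₀ ∈ (pilotDataOfK T.D T.K).S →
      ∃ mq : ℤ,
        ‖(exists_realising_qIdeles_pilotDataOfK T.D).choose pp x₀‖ =
          ((pp : ℕ) : ℝ) ^ (-((mq : ℝ) / absRamificationIdx (pp : ℕ) (kOf (pilotDataOfK T.D T.K) pp.1 x₀))) ∧
        (mq : ℝ) / absRamificationIdx (pp : ℕ) (kOf (pilotDataOfK T.D T.K) pp.1 x₀) =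
          -(Literature.IUT.LogVolume.ord P.F
              (finBelow P.F T.F (finBelow T.F T.K (placeOf (pilotDataOfK T.D T.K) pp.1 x₀))) (Cor22.jInv P.x) : ℝ) /
            (2 * l * ramIdx P.F (finBelow P.F T.F (finBelow T.F T.K (placeOf (pilotDataOfK T.D T.K) pp.1 x₀)))) := by
  letI := T.instFieldF; letI := T.instNumberFieldF; letI := T.instAlgebraF; letI := T.instFieldK
  letI := T.instNumberFieldK; letI := T.instAlgebraK; letI := T.instFieldFbar; letI := T.instAlgebraFbar
  letI := T.instAlgebraKFbar; letI := T.instIsElliptic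
  haveI : Fact (pp : ℕ).Prime := ⟨pp.2⟩
  intro x₀ hx₀S
  set w := placeOf (pilotDataOfK T.D T.K) pp.1 x₀ with hwdef
  set v := finBelow T.F T.K w with hvdef
  set v₀ := finBelow P.F T.F v with hv₀def
  have hw_under : w.under (𝓞 T.F) = v := rfl
  have hv_under : v.under (𝓞 P.F) = v₀ := rfl
  have hvVFbad : FinitePlace.mk v ∈ T.D.VFbad := (mem_pilotDataOfK_S_iff T.D T.K w).mp hx₀S
  -- the integer exponent and its value over `e(w|p)`
  obtain ⟨mq, hmq, hnorm⟩ := exists_int_norm_qIdele_pilotDataOfK T.D pp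
    (exists_realising_qIdeles_pilotDataOfK T.D).choose (exists_realising_qIdeles_pilotDataOfK T.D).choose_spec.1
    (exists_realising_qIdeles_pilotDataOfK T.D).choose_spec.2.2 x₀ hx₀S
  have hexp := qExponent_div_eq_pilotDataOfK T.D pp x₀ hx₀S hmq
  refine ⟨mq, hnorm, ?_⟩
  rw [hexp]
  -- `qParamOrd E v = −e(v|v₀)·ord_{v₀} j(λ)`
  have hq : (qParamOrd T.E v : ℤ) =
      -((Ideal.ramificationIdx' v₀.asIdeal v.asIdeal : ℤ) * Literature.IUT.LogVolume.ord P.F v₀ (Cor22.jInv P.x)) := by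
    have h1 := ThetaData.neg_ord_j_eq_ramificationIdx_mul_qParamOrd_of_under_mem_VFbad T.D (w := w)
      (by rw [hw_under]; exact hvVFbad)
    rw [hw_under] at h1
    have h2 : Literature.IUT.LogVolume.ord T.K w (algebraMap T.F T.K T.E.j) =
        (Ideal.ramificationIdx' v.asIdeal w.asIdeal : ℤ) *
          ((Ideal.ramificationIdx' v₀.asIdeal v.asIdeal : ℤ) * Literature.IUT.LogVolume.ord P.F v₀ (Cor22.jInv P.x)) := by
      rw [Cor22.ord_algebraMap_eq w, T.j_eq, Cor22.ord_algebraMap_eq v]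
    rw [h2] at h1
    have hne : (Ideal.ramificationIdx' v.asIdeal w.asIdeal : ℤ) ≠ 0 := by
      exact_mod_cast Ideal.IsDedekindDomain.ramificationIdx'_ne_zero_of_liesOver w.asIdeal v.ne_bot
    have h3 : (Ideal.ramificationIdx' v.asIdeal w.asIdeal : ℤ) * (qParamOrd T.E v : ℤ) =
        (Ideal.ramificationIdx' v.asIdeal w.asIdeal : ℤ) *
          -((Ideal.ramificationIdx' v₀.asIdeal v.asIdeal : ℤ) * Literature.IUT.LogVolume.ord P.F v₀ (Cor22.jInv P.x)) := by
      linarith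
    exact mul_left_cancel₀ hne h3
  -- `ramIdx F v = e(v₀|p)·e(v|v₀)`
  have hramv : (ramIdx T.F v : ℝ) = (ramIdx P.F v₀ : ℝ) * Ideal.ramificationIdx' v₀.asIdeal v.asIdeal := by
    rw [ramIdx_eq, ThetaData.absRamificationIdx_eq_ramIdx_mul (F := P.F) v, hv_under]
    push_cast
    rfl
  have hl0 : (l : ℝ) ≠ 0 := by exact_mod_cast (pilotDataOfK T.D T.K).l_prime.ne_zero
  have he0 : (ramIdx P.F v₀ : ℝ) ≠ 0 := by exact_mod_cast ramIdx_ne_zero P.F v₀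
  have hr0 : (Ideal.ramificationIdx' v₀.asIdeal v.asIdeal : ℝ) ≠ 0 := by
    exact_mod_cast Ideal.IsDedekindDomain.ramificationIdx'_ne_zero_of_liesOver v.asIdeal v₀.ne_bot
  have hq' : (qParamOrd T.E v : ℝ) =
      -((Ideal.ramificationIdx' v₀.asIdeal v.asIdeal : ℝ) * (Literature.IUT.LogVolume.ord P.F v₀ (Cor22.jInv P.x) : ℝ)) := by
    exact_mod_cast hq
  rw [hq', hramv]
  field_simp

end Genuine

/-! ## §2. At a RATIONAL point: `‖t_{q,x₀}‖ = p^{ord_p(j(λ))/(2l)}`, `l ∣ e(x₀|p)` when `l ∤ ord_p(j(λ))`, hence `l ≤ [K:ℚ]` -/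

section Rational

variable {q : ℚ} {l : ℕ} (T : Cor22.ThetaVolumeDatumAt (ratPoint q) l)

/-- The prime under the place `v₀` of `ℚ` below a fibre point over `p` is `p` (the place `v₀` is passed as a variable of type
`HeightOneSpectrum (𝓞 ℚ)` with its defining equation, so that statements about it live over `ℚ` verbatim). [folklore] -/
theorem GenuineK.natGenerator_eq_of_eq_finBelow_placeOf (pp : Nat.Primes) :
    letI := T.instFieldF; letI := T.instNumberFieldF; letI := T.instAlgebraF; letI := T.instFieldK
    letI := T.instNumberFieldK; letI := T.instAlgebraK; letI := T.instFieldFbar; letI := T.instAlgebraFbar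
    letI := T.instAlgebraKFbar; letI := T.instIsElliptic
    haveI : Fact (pp : ℕ).Prime := ⟨pp.2⟩
    ∀ (x₀ : (thetaIndex (pilotDataOfK T.D T.K)).Fibre (.inr pp)) (v₀ : HeightOneSpectrum (𝓞 ℚ)),
      v₀ = finBelow (ratPoint q).F T.F (finBelow T.F T.K (placeOf (pilotDataOfK T.D T.K) pp.1 x₀)) →
      Rat.HeightOneSpectrum.natGenerator v₀ = (pp : ℕ) := by
  letI := T.instFieldF; letI := T.instNumberFieldF; letI := T.instAlgebraF; letI := T.instFieldK
  letI := T.instNumberFieldK; letI := T.instAlgebraK; letI := T.instFieldFbar; letI := T.instAlgebraFbar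
  letI := T.instAlgebraKFbar; letI := T.instIsElliptic
  haveI : Fact (pp : ℕ).Prime := ⟨pp.2⟩
  intro x₀ v₀ hv₀
  set w := placeOf (pilotDataOfK T.D T.K) pp.1 x₀ with hwdef
  have hpw : ((pp : ℕ) : 𝓞 T.K) ∈ w.asIdeal := natCast_mem_placeOf (pilotDataOfK T.D T.K) pp.1 x₀
  have hpv : ((pp : ℕ) : 𝓞 T.F) ∈ (finBelow T.F T.K w).asIdeal := by
    change algebraMap (𝓞 T.F) (𝓞 T.K) ((pp : ℕ) : 𝓞 T.F) ∈ w.asIdeal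
    rw [map_natCast]; exact hpw
  have hpv₀ : ((pp : ℕ) : 𝓞 ℚ) ∈ v₀.asIdeal := by
    rw [hv₀]
    change algebraMap (𝓞 (ratPoint q).F) (𝓞 T.F) ((pp : ℕ) : 𝓞 (ratPoint q).F) ∈ (finBelow T.F T.K w).asIdeal
    rw [map_natCast]; exact hpv
  rw [UniformABCConjecture.natCast_mem_asIdeal_iff] at hpv₀
  exact (Nat.prime_dvd_prime_iff_eq (Rat.HeightOneSpectrum.prime_natGenerator _) pp.2).mp hpv₀

/-- **At a rational point `λ ∈ ℚ`: `‖t_{q,x₀}‖ = p^{ord_{v₀}(j(λ))/(2l)}` at EVERY bad place `x₀ | p` (`v₀` the place of `ℚ` under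
`x₀`), and `2l·m_q = −ord_{v₀}(j(λ))·e(x₀|p)` for an integer `m_q`** (§1 with `e(v₀|p) = 1`).
[cite: Mochizuki2012, IUTchI Ex. 3.2 (iv) p. 71; IUTchIV Cor. 2.2 (P2) p. 45] [claim: Mochizuki2012, status: disputed] -/
theorem GenuineK.norm_qIdele_chosen_ratPoint (pp : Nat.Primes) :
    letI := T.instFieldF; letI := T.instNumberFieldF; letI := T.instAlgebraF; letI := T.instFieldK
    letI := T.instNumberFieldK; letI := T.instAlgebraK; letI := T.instFieldFbar; letI := T.instAlgebraFbar
    letI := T.instAlgebraKFbar; letI := T.instIsElliptic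
    haveI : Fact (pp : ℕ).Prime := ⟨pp.2⟩
    ∀ (x₀ : (thetaIndex (pilotDataOfK T.D T.K)).Fibre (.inr pp)) (v₀ : HeightOneSpectrum (𝓞 ℚ)),
      v₀ = finBelow (ratPoint q).F T.F (finBelow T.F T.K (placeOf (pilotDataOfK T.D T.K) pp.1 x₀)) →
      placeOf (pilotDataOfK T.D T.K) pp.1 x₀ ∈ (pilotDataOfK T.D T.K).S →
      ‖(exists_realising_qIdeles_pilotDataOfK T.D).choose pp x₀‖ =
          ((pp : ℕ) : ℝ) ^ ((Literature.IUT.LogVolume.ord ℚ v₀ (Cor22.jInv q) : ℝ) / (2 * l)) ∧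
      ∃ mq : ℤ, 2 * (l : ℤ) * mq =
          -(Literature.IUT.LogVolume.ord ℚ v₀ (Cor22.jInv q)) * (absRamificationIdx (pp : ℕ) (kOf (pilotDataOfK T.D T.K) pp.1 x₀) : ℤ) := by
  letI := T.instFieldF; letI := T.instNumberFieldF; letI := T.instAlgebraF; letI := T.instFieldK
  letI := T.instNumberFieldK; letI := T.instAlgebraK; letI := T.instFieldFbar; letI := T.instAlgebraFbar
  letI := T.instAlgebraKFbar; letI := T.instIsElliptic
  haveI : Fact (pp : ℕ).Prime := ⟨pp.2⟩
  intro x₀ v₀ hv₀ hx₀S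
  obtain ⟨mq, hnorm, hrel⟩ := GenuineK.exists_int_norm_qIdele_chosen T pp x₀ hx₀S
  -- `e(v₀|p) = 1` over `ℚ` (the tree's `GenuineContent.ramIdx_rat_eq_one`, re-derived to keep the import closure small)
  have hram : ramIdx ℚ v₀ = 1 := by
    have h1 := ramificationIdx_int_le_finrank_rat (F₀ := ℚ) v₀
    rw [Module.finrank_self, ← ramIdx_eq] at h1
    have h2 : ramIdx ℚ v₀ ≠ 0 := ramIdx_ne_zero ℚ v₀
    omega
  have hrel' : (mq : ℝ) / absRamificationIdx (pp : ℕ) (kOf (pilotDataOfK T.D T.K) pp.1 x₀) =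
      -(Literature.IUT.LogVolume.ord ℚ v₀ (Cor22.jInv q) : ℝ) / (2 * l * (ramIdx ℚ v₀ : ℝ)) := by
    rw [hv₀]; exact hrel
  rw [hram, Nat.cast_one, mul_one] at hrel'
  have he0 : (0 : ℝ) < absRamificationIdx (pp : ℕ) (kOf (pilotDataOfK T.D T.K) pp.1 x₀) := by
    exact_mod_cast absRamificationIdx_pos _ _
  have hl0 : (0 : ℝ) < l := by exact_mod_cast (pilotDataOfK T.D T.K).l_prime.pos
  refine ⟨?_, mq, ?_⟩
  · rw [hnorm, hrel', neg_div, neg_neg]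
  · have h : (2 * (l : ℝ)) * mq =
        -(Literature.IUT.LogVolume.ord ℚ v₀ (Cor22.jInv q) : ℝ) * absRamificationIdx (pp : ℕ) (kOf (pilotDataOfK T.D T.K) pp.1 x₀) := by
      rw [div_eq_div_iff he0.ne' (by positivity)] at hrel'
      linarith
    exact_mod_cast h

/-- **`l ∣ e(x₀|p)` and `l ≤ [K:ℚ]` from ONE bad place `x₀ | p` with `l ∤ ord_{v₀}(j(λ))`** (`l` prime): `2l·m_q = −ord_{v₀}(j(λ))·e(x₀|p)`
forces `l ∣ e(x₀|p) ≤ [K:ℚ]` (the tree's `absRamificationIdx_rescaledCompletion_le_finrank_rat`). [cite: Mochizuki2012, IUTchI Def. 3.1 (c) p. 62]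
[cite: NeukirchANT1999, Ch. I Prop. (8.2)] [claim: Mochizuki2012, status: disputed] -/
theorem GenuineK.le_finrank_of_bad_place_ratPoint (hl : l.Prime) (pp : Nat.Primes) :
    letI := T.instFieldF; letI := T.instNumberFieldF; letI := T.instAlgebraF; letI := T.instFieldK
    letI := T.instNumberFieldK; letI := T.instAlgebraK; letI := T.instFieldFbar; letI := T.instAlgebraFbar
    letI := T.instAlgebraKFbar; letI := T.instIsElliptic
    haveI : Fact (pp : ℕ).Prime := ⟨pp.2⟩
    ∀ (x₀ : (thetaIndex (pilotDataOfK T.D T.K)).Fibre (.inr pp)) (v₀ : HeightOneSpectrum (𝓞 ℚ)),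
      v₀ = finBelow (ratPoint q).F T.F (finBelow T.F T.K (placeOf (pilotDataOfK T.D T.K) pp.1 x₀)) →
      placeOf (pilotDataOfK T.D T.K) pp.1 x₀ ∈ (pilotDataOfK T.D T.K).S →
      ¬ ((l : ℤ) ∣ Literature.IUT.LogVolume.ord ℚ v₀ (Cor22.jInv q)) →
      l ∣ absRamificationIdx (pp : ℕ) (kOf (pilotDataOfK T.D T.K) pp.1 x₀) ∧ l ≤ Module.finrank ℚ T.K := by
  letI := T.instFieldF; letI := T.instNumberFieldF; letI := T.instAlgebraF; letI := T.instFieldK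
  letI := T.instNumberFieldK; letI := T.instAlgebraK; letI := T.instFieldFbar; letI := T.instAlgebraFbar
  letI := T.instAlgebraKFbar; letI := T.instIsElliptic
  haveI : Fact (pp : ℕ).Prime := ⟨pp.2⟩
  intro x₀ v₀ hv₀ hx₀S hnd
  obtain ⟨-, mq, hmq⟩ := GenuineK.norm_qIdele_chosen_ratPoint T pp x₀ v₀ hv₀ hx₀S
  have hprime : Prime (l : ℤ) := Nat.prime_iff_prime_int.mp hl
  have hdvd : (l : ℤ) ∣ -(Literature.IUT.LogVolume.ord ℚ v₀ (Cor22.jInv q)) *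
        (absRamificationIdx (pp : ℕ) (kOf (pilotDataOfK T.D T.K) pp.1 x₀) : ℤ) := ⟨2 * mq, by rw [← hmq]; ring⟩
  have hle : l ∣ absRamificationIdx (pp : ℕ) (kOf (pilotDataOfK T.D T.K) pp.1 x₀) := by
    rcases hprime.dvd_or_dvd hdvd with h | h
    · exact absurd ((dvd_neg).mp h) hnd
    · exact_mod_cast h
  refine ⟨hle, (Nat.le_of_dvd (absRamificationIdx_pos _ _) hle).trans ?_⟩
  exact absRamificationIdx_rescaledCompletion_le_finrank_rat T.K pp.1 (placeOf (pilotDataOfK T.D T.K) pp.1 x₀)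
    (natCast_mem_placeOf (pilotDataOfK T.D T.K) pp.1 x₀)

end Rational

/-! ## §3. The degree-form depth locus is EMPTY at a rational point with small pole orders -/

section NotDeep

variable {q : ℚ} {l : ℕ} (T : Cor22.ThetaVolumeDatumAt (ratPoint q) l)

/-- **The degree-form depth locus of the window certificates is EMPTY at a genuine datum over a rational point with small pole
orders.** For `l` prime `≥ 5`, a genuine Θ-volume datum `T` over `(ratPoint λ, l)` with `3 ≤ [K:ℚ]`, and natural numbers `m, m₃`
with `m·(l−3) ≤ 16·l`, `m₃·(l−3) ≤ 24·l` bounding the pole orders of `j(λ)` (`−m ≤ ord_p(j(λ))` at `p ≠ 3`, `−m₃ ≤ ord_3(j(λ))`):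
NO prime `p > 2`, label index `i` and fibre point `x₀ | p` satisfy `p^{((i+2)(4 + 2·log_p[K:ℚ]) + 1)}·‖t_{q,x₀}‖^{(i+1)²−1} < 1`
(the `hdeep` disjunct of `Conditional.abc_of_SH_v10K_window…`, verbatim). Off the bad set `‖t_{q,x₀}‖ = 1`; at a bad place
`‖t_{q,x₀}‖ = p^{ord_p(j(λ))/(2l)} ≥ p^{−M/(2l)}` (§2) and `(M/(2l))·i ≤ M(l−3)/(4l) ≤ 4 + 2·log_p[K:ℚ]` (`i ≤ (l−3)/2`; at `p = 3`
using `log_3[K:ℚ] ≥ 1`). [cite: Mochizuki2012, IUTchIV Prop. 1.2 p. 10, Cor. 2.2 (P2) p. 45] [claim: Mochizuki2012, status: disputed] -/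
theorem GenuineK.not_degreeDeep_ratPoint (hl : l.Prime) (h5 : 5 ≤ l) (m m₃ : ℕ)
    (hm : m * (l - 3) ≤ 16 * l) (hm₃ : m₃ * (l - 3) ≤ 24 * l)
    (hord : ∀ v : HeightOneSpectrum (𝓞 ℚ), Rat.HeightOneSpectrum.natGenerator v ≠ 3 →
      -(m : ℤ) ≤ Literature.IUT.LogVolume.ord ℚ v (Cor22.jInv q))
    (hord₃ : ∀ v : HeightOneSpectrum (𝓞 ℚ), Rat.HeightOneSpectrum.natGenerator v = 3 →
      -(m₃ : ℤ) ≤ Literature.IUT.LogVolume.ord ℚ v (Cor22.jInv q))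
    (hK : letI := T.instFieldF; letI := T.instNumberFieldF; letI := T.instAlgebraF; letI := T.instFieldK
      letI := T.instNumberFieldK; letI := T.instAlgebraK; letI := T.instFieldFbar; letI := T.instAlgebraFbar
      letI := T.instAlgebraKFbar; letI := T.instIsElliptic
      3 ≤ Module.finrank ℚ T.K) :
    letI := T.instFieldF; letI := T.instNumberFieldF; letI := T.instAlgebraF; letI := T.instFieldK
    letI := T.instNumberFieldK; letI := T.instAlgebraK; letI := T.instFieldFbar; letI := T.instAlgebraFbar
    letI := T.instAlgebraKFbar; letI := T.instIsElliptic
    ¬ (∃ (pp : Nat.Primes) (_ : 2 < (pp : ℕ)) (i : Fin (thetaIndex (pilotDataOfK T.D T.K)).lstar)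
          (x₀ : (thetaIndex (pilotDataOfK T.D T.K)).Fibre (.inr pp)),
        haveI : Fact (pp : ℕ).Prime := ⟨pp.2⟩
        ((pp : ℕ) : ℝ) ^ ((((i : ℕ) : ℝ) + 2) * (4 + 2 * Real.logb (pp : ℕ) (Module.finrank ℚ T.K)) + 1) *
          ‖(exists_realising_qIdeles_pilotDataOfK T.D).choose pp x₀‖ ^ (((i : ℕ) + 1) ^ 2 - 1) < 1) := by
  letI := T.instFieldF; letI := T.instNumberFieldF; letI := T.instAlgebraF; letI := T.instFieldK
  letI := T.instNumberFieldK; letI := T.instAlgebraK; letI := T.instFieldFbar; letI := T.instAlgebraFbar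
  letI := T.instAlgebraKFbar; letI := T.instIsElliptic
  rintro ⟨pp, hp2, i, x₀, hlt⟩
  haveI : Fact (pp : ℕ).Prime := ⟨pp.2⟩
  have hp1 : (1 : ℝ) < ((pp : ℕ) : ℝ) := by exact_mod_cast pp.2.one_lt
  have hp0 : (0 : ℝ) < ((pp : ℕ) : ℝ) := lt_trans zero_lt_one hp1
  have hK1 : (1 : ℝ) ≤ (Module.finrank ℚ T.K : ℝ) := by exact_mod_cast Module.finrank_pos
  have hK3 : (3 : ℝ) ≤ (Module.finrank ℚ T.K : ℝ) := by exact_mod_cast hK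
  have hL0 : 0 ≤ Real.logb ((pp : ℕ) : ℝ) (Module.finrank ℚ T.K : ℝ) := Real.logb_nonneg hp1 hK1
  -- the label index: `2i + 3 ≤ l`
  have hodd : l % 2 = 1 := by
    rcases hl.eq_two_or_odd with h | h
    · omega
    · exact h
  have hlstar : (thetaIndex (pilotDataOfK T.D T.K)).lstar = (l - 1) / 2 := rfl
  have hi : 2 * (i : ℕ) + 3 ≤ l := by
    have h1 : (i : ℕ) < (thetaIndex (pilotDataOfK T.D T.K)).lstar := i.2
    omega
  have hiR : 2 * ((i : ℕ) : ℝ) + 3 ≤ (l : ℝ) := by exact_mod_cast hi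
  have hi0 : (0 : ℝ) ≤ ((i : ℕ) : ℝ) := Nat.cast_nonneg _
  have hB : ((((i : ℕ) + 1) ^ 2 - 1 : ℕ) : ℝ) = ((i : ℕ) : ℝ) * (((i : ℕ) : ℝ) + 2) := by
    have : 1 ≤ ((i : ℕ) + 1) ^ 2 := Nat.one_le_pow _ _ (by omega)
    push_cast [Nat.cast_sub this]
    ring
  have hA0 : 0 ≤ (((i : ℕ) : ℝ) + 2) * (4 + 2 * Real.logb ((pp : ℕ) : ℝ) (Module.finrank ℚ T.K : ℝ)) + 1 := by positivity
  by_cases hS : placeOf (pilotDataOfK T.D T.K) pp.1 x₀ ∈ (pilotDataOfK T.D T.K).S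
  · -- a bad place: `‖t_{q,x₀}‖ = p^{ord_{v₀}(j(λ))/(2l)}`
    set v₀ : HeightOneSpectrum (𝓞 ℚ) :=
      finBelow (ratPoint q).F T.F (finBelow T.F T.K (placeOf (pilotDataOfK T.D T.K) pp.1 x₀)) with hv₀def
    have hgen := GenuineK.natGenerator_eq_of_eq_finBelow_placeOf T pp x₀ v₀ hv₀def
    obtain ⟨hnorm, -⟩ := GenuineK.norm_qIdele_chosen_ratPoint T pp x₀ v₀ hv₀def hS
    -- the pole-order bound `M` and the base lower bound `L₀` for `log_p [K:ℚ]`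
    obtain ⟨M, L₀, hMle, hL₀L, hordM⟩ : ∃ (M : ℕ) (L₀ : ℝ),
        (M : ℝ) * ((l : ℝ) - 3) ≤ (16 + 8 * L₀) * l ∧
        L₀ ≤ Real.logb ((pp : ℕ) : ℝ) (Module.finrank ℚ T.K : ℝ) ∧
        -(M : ℤ) ≤ Literature.IUT.LogVolume.ord ℚ v₀ (Cor22.jInv q) := by
      have h3l : 3 ≤ l := by omega
      by_cases h3 : Rat.HeightOneSpectrum.natGenerator v₀ = 3
      · refine ⟨m₃, 1, ?_, ?_, hord₃ v₀ h3⟩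
        · have h := (Nat.cast_le (α := ℝ)).mpr hm₃
          push_cast [Nat.cast_sub h3l] at h
          linarith
        · have hpp3 : ((pp : ℕ) : ℝ) = 3 := by rw [← hgen, h3]; norm_num
          rw [hpp3, ← Real.logb_self_eq_one (b := (3 : ℝ)) (by norm_num)]
          exact Real.logb_le_logb_of_le (by norm_num) (by norm_num) hK3
      · refine ⟨m, 0, ?_, by simpa using hL0, hord v₀ h3⟩
        have h := (Nat.cast_le (α := ℝ)).mpr hm
        push_cast [Nat.cast_sub h3l] at h
        linarith
    -- the exponent is nonnegative
    rw [hnorm, ← Real.rpow_natCast, ← Real.rpow_mul hp0.le, ← Real.rpow_add hp0, hB] at hlt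
    refine absurd hlt (not_lt.mpr (Real.one_le_rpow hp1.le ?_))
    set t : ℝ := (Literature.IUT.LogVolume.ord ℚ v₀ (Cor22.jInv q) : ℝ) with ht
    set L : ℝ := Real.logb ((pp : ℕ) : ℝ) (Module.finrank ℚ T.K : ℝ) with hL
    set c : ℝ := (M : ℝ) / (2 * l) with hc
    have hl0 : (0 : ℝ) < l := by exact_mod_cast hl.pos
    have hM0 : (0 : ℝ) ≤ M := Nat.cast_nonneg _
    have htM : -(M : ℝ) ≤ t := by rw [ht]; exact_mod_cast hordM
    have hct : -c ≤ t / (2 * l) := by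
      rw [hc, ← neg_div]
      exact div_le_div_of_nonneg_right htM (by positivity)
    have hMi : (M : ℝ) * ((i : ℕ) : ℝ) ≤ (8 + 4 * L₀) * l := by
      have h1 : (M : ℝ) * (2 * ((i : ℕ) : ℝ)) ≤ (M : ℝ) * ((l : ℝ) - 3) := mul_le_mul_of_nonneg_left (by linarith) hM0
      linarith
    have hkey : c * ((i : ℕ) : ℝ) ≤ 4 + 2 * L₀ := by
      rw [hc, div_mul_eq_mul_div, div_le_iff₀ (by positivity)]
      linarith
    have h1 : -c * (((i : ℕ) : ℝ) * (((i : ℕ) : ℝ) + 2)) ≤ t / (2 * l) * (((i : ℕ) : ℝ) * (((i : ℕ) : ℝ) + 2)) :=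
      mul_le_mul_of_nonneg_right hct (by positivity)
    have h2 : 0 ≤ (((i : ℕ) : ℝ) + 2) * (4 + 2 * L - c * ((i : ℕ) : ℝ)) := mul_nonneg (by positivity) (by linarith)
    nlinarith [h1, h2]
  · -- off the bad set the q-idele is a unit
    have h1 : ‖(exists_realising_qIdeles_pilotDataOfK T.D).choose pp x₀‖ = 1 :=
      (exists_realising_qIdeles_pilotDataOfK T.D).choose_spec.2.1 pp x₀ hS
    rw [h1, one_pow, mul_one] at hlt
    exact absurd hlt (not_lt.mpr (Real.one_le_rpow hp1.le hA0))

end NotDeep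

end Summit.ABC.IUTFork.Conditional

end
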